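import Literature.NumberTheory.Automorphic.SmoothInduction
import Literature.NumberTheory.Automorphic.AdmissibleSubquotient
import Literature.NumberTheory.Automorphic.JacquetModule
import Mathlib.RingTheory.FiniteLength
import HarnessLib

/-!
# Transport of structure for smooth induction along a group isomorphism

Generic plumbing. Let `φ : G' ≃* G` be an isomorphism of topological groups (continuous both
ways), `H ≤ G`, `H' ≤ G'` with `φ(H') = H`, and `σ`, `σ'` representations of `H`, `H'` on the same
space with `σ' = σ ∘ φ`.

* `SmoothInd.transport` / `SmoothInd.transportEquiv`: `f ↦ f ∘ φ⁻¹` is a linear isomorphism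
  `Ind_{H'}^{G'} σ' ≃ Ind_H^G σ` intertwining the actions along `φ` (`transport_smoothIndRep`);
* `Representation.isFiniteLength_iff_of_equivariant_equiv`: representations of `G'` and `G`
  related by a `φ`-equivariant linear isomorphism have the same lattice of subrepresentations, hence
  one has finite length iff the other has; likewise admissibility (`IsAdmissible.of_equivariant_equiv`)
  and irreducibility transfer;
* `modularCharacter_continuousMulEquiv` / `rootDeltaChar_transport`: the modulus character is
  invariant under isomorphisms of locally compact groups (uniqueness of Haar measure), so
  `δ_{H'}^{1/2} = δ_H^{1/2} ∘ φ`.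

Definitions `SmoothInd.transport`, `SmoothInd.transportEquiv`, `Subrepresentation.transportOrderIso`;
theorems otherwise; no named facts. [folklore]

## References

* I. N. Bernstein, A. V. Zelevinsky, Russian Math. Surveys 31:3 (1976), §2.21–2.25 (induction),
  1.19 (modulus).
-/

noncomputable section

open scoped Pointwise NNReal
open MeasureTheory

/-! ### Equivariant equivalences: subrepresentations, finite length, admissibility -/

namespace Representation

section Equivariant

variable {k G G' V V' : Type*} [CommRing k] [Group G] [Group G'] [AddCommGroup V] [Module k V]
  [AddCommGroup V'] [Module k V'] {ρ : Representation k G V} {ρ' : Representation k G' V'}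
  (φ : G' ≃* G) (Ψ : V' ≃ₗ[k] V) (hΨ : ∀ g' v, Ψ (ρ' g' v) = ρ (φ g') (Ψ v))

include hΨ in
/-- The inverse equivariance: `Ψ⁻¹ (ρ g v) = ρ' (φ⁻¹ g) (Ψ⁻¹ v)`. [folklore] -/
theorem symm_apply_of_equivariant (g : G) (v : V) : Ψ.symm (ρ g v) = ρ' (φ.symm g) (Ψ.symm v) := by
  apply Ψ.injective
  rw [hΨ, LinearEquiv.apply_symm_apply, LinearEquiv.apply_symm_apply, MulEquiv.apply_symm_apply]

/-- **Transport of subrepresentations** along a `φ`-equivariant linear isomorphism: the image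
under `Ψ` of a subrepresentation of `ρ'` is a subrepresentation of `ρ`, and this is an order
isomorphism. [folklore] -/
def _root_.Subrepresentation.transportOrderIso : Subrepresentation ρ' ≃o Subrepresentation ρ where
  toFun S := ⟨S.toSubmodule.map Ψ.toLinearMap, by
    rintro g _ ⟨v, hv, rfl⟩
    refine ⟨ρ' (φ.symm g) v, S.apply_mem_toSubmodule _ hv, ?_⟩
    change Ψ (ρ' (φ.symm g) v) = ρ g (Ψ v)
    rw [hΨ, MulEquiv.apply_symm_apply]⟩
  invFun T := ⟨T.toSubmodule.map Ψ.symm.toLinearMap, by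
    rintro g' _ ⟨v, hv, rfl⟩
    refine ⟨ρ (φ g') v, T.apply_mem_toSubmodule _ hv, ?_⟩
    change Ψ.symm (ρ (φ g') v) = ρ' g' (Ψ.symm v)
    rw [symm_apply_of_equivariant φ Ψ hΨ, MulEquiv.symm_apply_apply]⟩
  left_inv S := by
    apply Subrepresentation.toSubmodule_injective
    change (S.toSubmodule.map Ψ.toLinearMap).map Ψ.symm.toLinearMap = S.toSubmodule
    rw [← Submodule.map_comp]
    convert Submodule.map_id S.toSubmodule
    ext v
    simp
  right_inv T := by
    apply Subrepresentation.toSubmodule_injective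
    change (T.toSubmodule.map Ψ.symm.toLinearMap).map Ψ.toLinearMap = T.toSubmodule
    rw [← Submodule.map_comp]
    convert Submodule.map_id T.toSubmodule
    ext v
    simp
  map_rel_iff' {S₁ S₂} := by
    constructor
    · intro h v hv
      have : Ψ v ∈ S₂.toSubmodule.map Ψ.toLinearMap := h ⟨v, hv, rfl⟩
      obtain ⟨w, hw, hwv⟩ := this
      rw [← Ψ.injective hwv]
      exact hw
    · intro h _ ⟨v, hv, hv'⟩
      exact ⟨v, h hv, hv'⟩

include hΨ in
/-- **Finite length is invariant under equivariant isomorphism** (along a group isomorphism):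
the lattices of subrepresentations, hence of submodules over the group algebras, are isomorphic.
[folklore] -/
theorem isFiniteLength_iff_of_equivariant_equiv :
    IsFiniteLength (MonoidAlgebra k G') ρ'.asModule ↔ IsFiniteLength (MonoidAlgebra k G) ρ.asModule := by
  have e : Submodule (MonoidAlgebra k G') ρ'.asModule ≃o Submodule (MonoidAlgebra k G) ρ.asModule :=
    (Subrepresentation.subrepresentationSubmoduleOrderIso.symm.trans
      (Subrepresentation.transportOrderIso φ Ψ hΨ)).trans Subrepresentation.subrepresentationSubmoduleOrderIso
  rw [isFiniteLength_iff_isNoetherian_isArtinian, isFiniteLength_iff_isNoetherian_isArtinian,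
    isNoetherian_iff', isNoetherian_iff']
  -- `IsArtinian` is `WellFoundedLT` by definition
  exact and_congr
    ⟨fun h => by haveI := h; exact e.symm.toOrderEmbedding.wellFoundedGT,
      fun h => by haveI := h; exact e.toOrderEmbedding.wellFoundedGT⟩
    ⟨fun h => by haveI := h; exact e.symm.toOrderEmbedding.wellFoundedLT,
      fun h => by haveI := h; exact e.toOrderEmbedding.wellFoundedLT⟩

end Equivariant

section EquivariantField

variable {k G G' V V' : Type*} [Field k] [Group G] [Group G'] [AddCommGroup V] [Module k V]
  [AddCommGroup V'] [Module k V'] {ρ : Representation k G V} {ρ' : Representation k G' V'}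
  (φ : G' ≃* G) (Ψ : V' ≃ₗ[k] V) (hΨ : ∀ g' v, Ψ (ρ' g' v) = ρ (φ g') (Ψ v))

include hΨ in
/-- Irreducibility transfers along an equivariant isomorphism. [folklore] -/
theorem isIrreducible_of_equivariant_equiv [ρ'.IsIrreducible] : ρ.IsIrreducible :=
  (OrderIso.isSimpleOrder_iff (Subrepresentation.transportOrderIso φ Ψ hΨ)).1 ‹ρ'.IsIrreducible›

variable [TopologicalSpace G] [SeparatelyContinuousMul G] [TopologicalSpace G'] (hφ : Continuous φ)
  (hφ' : Continuous φ.symm)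

include hΨ hφ' in
/-- Smoothness transfers along an equivariant isomorphism (`φ⁻¹` continuous). [folklore] -/
theorem IsSmooth.of_equivariant_equiv (h : ρ'.IsSmooth) : ρ.IsSmooth := by
  intro v
  have hopen : IsOpen (φ.symm ⁻¹' ((ρ'.stabilizerSubgroup (Ψ.symm v) : Subgroup G') : Set G')) :=
    (h (Ψ.symm v)).preimage hφ'
  refine ρ.isSmoothVector_of_le (K := (ρ'.stabilizerSubgroup (Ψ.symm v)).comap φ.symm.toMonoidHom) hopen fun g hg => ?_
  rw [Subgroup.mem_comap, mem_stabilizerSubgroup] at hg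
  rw [mem_stabilizerSubgroup]
  have := congrArg Ψ hg
  rw [hΨ] at this
  change ρ (φ (φ.symm g)) (Ψ (Ψ.symm v)) = Ψ (Ψ.symm v) at this
  rwa [MulEquiv.apply_symm_apply, LinearEquiv.apply_symm_apply] at this

include hΨ hφ hφ' in
/-- **Admissibility transfers along an equivariant isomorphism** (`φ` a homeomorphism): the
`K`-fixed vectors of `ρ` are the image of the `φ⁻¹(K)`-fixed vectors of `ρ'`. [folklore] -/
theorem IsAdmissible.of_equivariant_equiv (h : ρ'.IsAdmissible) : ρ.IsAdmissible := by
  refine ⟨IsSmooth.of_equivariant_equiv φ Ψ hΨ hφ' h.isSmooth, fun K hK => ?_⟩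
  -- `K' = φ⁻¹(K)`, compact open in `G'`
  let K' : Subgroup G' := (K : Subgroup G).comap φ.toMonoidHom
  have hK'o : IsOpen (K' : Set G') := K.isOpen.preimage hφ
  have hK'c : IsCompact (K' : Set G') := by
    have : (K' : Set G') = φ.symm '' (K : Set G) := by
      ext x
      simp only [SetLike.mem_coe, Set.mem_image]
      constructor
      · intro hx; exact ⟨φ x, hx, φ.symm_apply_apply x⟩
      · rintro ⟨y, hy, rfl⟩
        change φ (φ.symm y) ∈ K
        rw [MulEquiv.apply_symm_apply]
        exact hy
    rw [this]
    exact hK.image hφ'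
  haveI : Module.Finite k (ρ'.fixedPoints K') := h.2 ⟨K', hK'o⟩ hK'c
  have heq : ρ.fixedPoints (K : Subgroup G) = (ρ'.fixedPoints K').map Ψ.toLinearMap := by
    ext v
    simp only [mem_fixedPoints, Submodule.mem_map]
    constructor
    · intro hv
      refine ⟨Ψ.symm v, fun g' hg' => ?_, Ψ.apply_symm_apply v⟩
      apply Ψ.injective
      rw [hΨ, LinearEquiv.apply_symm_apply]
      exact hv _ hg'
    · rintro ⟨w, hw, rfl⟩ g hg
      have := hw (φ.symm g) (show φ (φ.symm g) ∈ K by rw [MulEquiv.apply_symm_apply]; exact hg)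
      change ρ g (Ψ w) = Ψ w
      rw [← MulEquiv.apply_symm_apply φ g, ← hΨ, this]
  rw [heq]
  infer_instance

end EquivariantField

/-! ### Transport of smooth induction -/

section SmoothInd

variable {k G G' W : Type*} [CommRing k] [Group G] [Group G'] [TopologicalSpace G] [TopologicalSpace G']
  [IsTopologicalGroup G] [IsTopologicalGroup G'] [AddCommGroup W] [Module k W]

omit [TopologicalSpace G] [TopologicalSpace G'] [IsTopologicalGroup G] [IsTopologicalGroup G'] in
/-- If `φ(H') = H` then `φ⁻¹` maps `H` into `H'`. [folklore] -/
theorem symm_mem_of_mem (φ : G' ≃* G) {H : Subgroup G} {H' : Subgroup G'} (hH : ∀ x, φ x ∈ H ↔ x ∈ H')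
    {h : G} (hh : h ∈ H) : φ.symm h ∈ H' := by
  rw [← hH, MulEquiv.apply_symm_apply]; exact hh

/-- **Transport of an induced vector**: `f ↦ f ∘ φ⁻¹` from `Ind_{H'}^{G'} σ'` to `Ind_H^G σ`
(left `H`-equivariance from `σ' = σ ∘ φ`, smoothness from the continuity of `φ⁻¹`). [folklore] -/
def SmoothInd.transport (φ : G' ≃* G) (hφ' : Continuous φ.symm) {H : Subgroup G} {H' : Subgroup G'}
    (hH : ∀ x, φ x ∈ H ↔ x ∈ H') {σ : Representation k H W} {σ' : Representation k H' W}
    (hσ : ∀ x : H', σ' x = σ ⟨φ x, (hH x).2 x.2⟩) (f : SmoothInd H' σ') : SmoothInd H σ :=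
  (⟨⟨fun g => f.toFun (φ.symm g), (mem_indFun_iff H σ _).2 fun h g => by
      rw [map_mul, show φ.symm (h : G) = ((⟨φ.symm h, symm_mem_of_mem φ hH h.2⟩ : H') : G') from rfl,
        f.toFun_subgroup_mul, hσ]
      congr 2
      apply Subtype.ext
      exact MulEquiv.apply_symm_apply φ h⟩,
    by
      have hopen : IsOpen (((indFun H' σ').stabilizerSubgroup
          (show ↥(smoothInd H' σ').toSubmodule from f).1 : Subgroup G') : Set G') :=
        (show ↥(smoothInd H' σ').toSubmodule from f).2
      refine (indFun H σ).isSmoothVector_of_le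
        (K := ((indFun H' σ').stabilizerSubgroup (show ↥(smoothInd H' σ').toSubmodule from f).1).comap φ.symm.toMonoidHom)
        (hopen.preimage hφ') fun κ hκ => ?_
      rw [Subgroup.mem_comap, mem_stabilizerSubgroup] at hκ
      rw [mem_stabilizerSubgroup]
      apply Subtype.ext
      funext x
      change f.toFun (φ.symm (x * κ)) = f.toFun (φ.symm x)
      have := congrArg (fun u : coindV H'.subtype σ' => (u : G' → W) (φ.symm x)) hκ
      rw [map_mul]
      exact this⟩ : ↥(smoothInd H σ).toSubmodule)

/-- The underlying function of the transported vector. [folklore] -/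
@[simp] theorem SmoothInd.toFun_transport (φ : G' ≃* G) (hφ' : Continuous φ.symm) {H : Subgroup G} {H' : Subgroup G'}
    (hH : ∀ x, φ x ∈ H ↔ x ∈ H') {σ : Representation k H W} {σ' : Representation k H' W}
    (hσ : ∀ x : H', σ' x = σ ⟨φ x, (hH x).2 x.2⟩) (f : SmoothInd H' σ') (g : G) :
    (SmoothInd.transport φ hφ' hH hσ f).toFun g = f.toFun (φ.symm g) := rfl

omit [TopologicalSpace G] [TopologicalSpace G'] [IsTopologicalGroup G] [IsTopologicalGroup G'] in
/-- The swapped subgroup compatibility for `φ⁻¹`. [folklore] -/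
theorem symm_compat (φ : G' ≃* G) {H : Subgroup G} {H' : Subgroup G'} (hH : ∀ x, φ x ∈ H ↔ x ∈ H')
    (y : G) : φ.symm y ∈ H' ↔ y ∈ H := by
  rw [← hH, MulEquiv.apply_symm_apply]

omit [TopologicalSpace G] [TopologicalSpace G'] [IsTopologicalGroup G] [IsTopologicalGroup G'] in
/-- The swapped representation compatibility for `φ⁻¹`: `σ = σ' ∘ φ⁻¹`. [folklore] -/
theorem symm_compat_rep (φ : G' ≃* G) {H : Subgroup G} {H' : Subgroup G'} (hH : ∀ x, φ x ∈ H ↔ x ∈ H')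
    {σ : Representation k H W} {σ' : Representation k H' W} (hσ : ∀ x : H', σ' x = σ ⟨φ x, (hH x).2 x.2⟩)
    (y : H) : σ y = σ' ⟨φ.symm y, (symm_compat φ hH y).2 y.2⟩ := by
  rw [hσ]
  congr 1
  apply Subtype.ext
  exact (MulEquiv.apply_symm_apply φ y).symm

/-- **Transport of smooth induction along a group isomorphism**, as a linear isomorphism
`Ind_{H'}^{G'} σ' ≃ Ind_H^G σ` (`f ↦ f ∘ φ⁻¹`, inverse `f ↦ f ∘ φ`). [folklore] -/
def SmoothInd.transportEquiv (φ : G' ≃* G) (hφ : Continuous φ) (hφ' : Continuous φ.symm)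
    {H : Subgroup G} {H' : Subgroup G'} (hH : ∀ x, φ x ∈ H ↔ x ∈ H')
    {σ : Representation k H W} {σ' : Representation k H' W} (hσ : ∀ x : H', σ' x = σ ⟨φ x, (hH x).2 x.2⟩) :
    SmoothInd H' σ' ≃ₗ[k] SmoothInd H σ where
  toFun := SmoothInd.transport φ hφ' hH hσ
  map_add' f g := SmoothInd.ext (funext fun x => by
    simp only [SmoothInd.toFun_transport, SmoothInd.toFun_add, Pi.add_apply])
  map_smul' c f := SmoothInd.ext (funext fun x => by
    simp only [SmoothInd.toFun_transport, SmoothInd.toFun_smul, Pi.smul_apply, RingHom.id_apply])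
  invFun := SmoothInd.transport φ.symm (by simpa using hφ) (symm_compat φ hH) (symm_compat_rep φ hH hσ)
  left_inv f := SmoothInd.ext (funext fun x => by
    simp only [SmoothInd.toFun_transport, MulEquiv.symm_symm, MulEquiv.symm_apply_apply])
  right_inv f := SmoothInd.ext (funext fun x => by
    simp only [SmoothInd.toFun_transport, MulEquiv.symm_symm, MulEquiv.apply_symm_apply])

/-- The underlying function of `transportEquiv f` is `f ∘ φ⁻¹`. [folklore] -/
@[simp] theorem SmoothInd.toFun_transportEquiv (φ : G' ≃* G) (hφ : Continuous φ) (hφ' : Continuous φ.symm)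
    {H : Subgroup G} {H' : Subgroup G'} (hH : ∀ x, φ x ∈ H ↔ x ∈ H')
    {σ : Representation k H W} {σ' : Representation k H' W} (hσ : ∀ x : H', σ' x = σ ⟨φ x, (hH x).2 x.2⟩)
    (f : SmoothInd H' σ') (g : G) :
    (SmoothInd.transportEquiv φ hφ hφ' hH hσ f).toFun g = f.toFun (φ.symm g) := rfl

/-- **Equivariance of the transport**: `Ψ (g' • f) = φ(g') • Ψ f`. [folklore] -/
theorem SmoothInd.transportEquiv_smoothIndRep (φ : G' ≃* G) (hφ : Continuous φ) (hφ' : Continuous φ.symm)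
    {H : Subgroup G} {H' : Subgroup G'} (hH : ∀ x, φ x ∈ H ↔ x ∈ H')
    {σ : Representation k H W} {σ' : Representation k H' W} (hσ : ∀ x : H', σ' x = σ ⟨φ x, (hH x).2 x.2⟩)
    (g' : G') (f : SmoothInd H' σ') :
    SmoothInd.transportEquiv φ hφ hφ' hH hσ (smoothIndRep H' σ' g' f) =
      smoothIndRep H σ (φ g') (SmoothInd.transportEquiv φ hφ hφ' hH hσ f) :=
  SmoothInd.ext (funext fun x => by
    simp only [SmoothInd.toFun_transportEquiv, toFun_smoothIndRep_apply, map_mul, MulEquiv.symm_apply_apply])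

end SmoothInd

end Representation

/-! ### Invariance of the modulus character under isomorphisms -/

namespace MeasureTheory.Measure

variable {A B : Type*} [Group A] [Group B] [TopologicalSpace A] [TopologicalSpace B]
  [IsTopologicalGroup A] [IsTopologicalGroup B] [LocallyCompactSpace A] [LocallyCompactSpace B]

/-- **The modular character is invariant under isomorphisms of locally compact groups**:
`Δ_B(φ a) = Δ_A(a)`. Both sides are quotients of integrals of a test function against
right-translated Haar measures (`haarScalarFactor_eq_integral_div`), which agree after the change
of variables `φ` (as in Mathlib's `haarScalarFactor_map`). [folklore] -/
theorem modularCharacter_continuousMulEquiv (φ : A ≃ₜ* B) (a : A) :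
    modularCharacter (φ a) = modularCharacter a := by
  borelize A B
  set μ : Measure A := MeasureTheory.Measure.haar with hμ
  change modularCharacterFun (φ a) = modularCharacterFun a
  rw [modularCharacterFun_eq_haarScalarFactor (map φ μ) (φ a), modularCharacterFun_eq_haarScalarFactor μ a]
  obtain ⟨⟨f, f_cont⟩, hf⟩ := exists_continuous_nonneg_pos (1 : B)
  have hφm : AEMeasurable (⇑φ) μ := φ.continuous.measurable.aemeasurable
  have hfφ_cont : Continuous fun x : A => f (φ x) := f_cont.comp φ.continuous
  have hfφ_supp : HasCompactSupport fun x : A => f (φ x) := hf.1.comp_homeomorph φ.toHomeomorph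
  have int_ne : ∫ x, f (φ x) ∂μ ≠ 0 := by
    refine ne_of_gt (hfφ_cont.integral_pos_of_hasCompactSupport_nonneg_nonzero hfφ_supp (fun x => hf.2.1 _)
      (x := 1) ?_)
    rw [map_one]
    exact hf.2.2
  rw [← NNReal.coe_inj, haarScalarFactor_eq_integral_div_of_continuous_nonneg_pos _ _ hf,
    haarScalarFactor_eq_integral_div _ μ hfφ_cont hfφ_supp int_ne]
  -- numerators and denominators agree after the change of variables `φ`
  have hnum : ∫ y, f y ∂(map (· * φ a) (map φ μ)) = ∫ x, f (φ x) ∂(map (· * a) μ) := by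
    rw [integral_map (measurable_mul_const _).aemeasurable f_cont.aestronglyMeasurable,
      integral_map hφm (show AEStronglyMeasurable (fun y : B => f (y * φ a)) (map (⇑φ) μ) from
        (f_cont.comp (continuous_id.mul continuous_const)).aestronglyMeasurable),
      integral_map (measurable_mul_const a).aemeasurable hfφ_cont.aestronglyMeasurable]
    simp only [map_mul]
  have hden : ∫ y, f y ∂(map φ μ) = ∫ x, f (φ x) ∂μ := by
    rw [integral_map hφm f_cont.aestronglyMeasurable]
  change (∫ y, f y ∂(map (· * φ a) (map φ μ))) / ∫ y, f y ∂(map φ μ) = _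
  rw [hnum, hden]

end MeasureTheory.Measure

namespace Representation

open Literature.NumberTheory.Automorphic

/-- **The square root of the modulus character is invariant under isomorphisms**: for an
isomorphism of topological groups `φ : G' ≃* G` mapping `H'` onto `H` (both locally compact),
`δ_{H'}^{1/2}(x) = δ_H^{1/2}(φ x)`. [folklore] -/
theorem rootDeltaChar_transport {G G' : Type*} [Group G] [Group G'] [TopologicalSpace G] [TopologicalSpace G']
    [IsTopologicalGroup G] [IsTopologicalGroup G'] (φ : G' ≃* G) (hφ : Continuous φ) (hφ' : Continuous φ.symm)
    {H : Subgroup G} {H' : Subgroup G'} (hH : ∀ x, φ x ∈ H ↔ x ∈ H')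
    [LocallyCompactSpace H] [LocallyCompactSpace H'] (x : H') :
    rootDeltaChar H' x = rootDeltaChar H ⟨φ x, (hH x).2 x.2⟩ := by
  -- the induced isomorphism of topological groups `H' ≃ₜ* H`
  let ψ : H' ≃ₜ* H :=
    { toFun := fun y => ⟨φ (y : G'), (hH y).2 y.2⟩
      invFun := fun z => ⟨φ.symm (z : G), symm_mem_of_mem φ hH z.2⟩
      left_inv := fun y => Subtype.ext (φ.symm_apply_apply (y : G'))
      right_inv := fun z => Subtype.ext (φ.apply_symm_apply (z : G))
      map_mul' := fun y z => Subtype.ext (map_mul φ (y : G') (z : G'))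
      continuous_toFun := (hφ.comp continuous_subtype_val).subtype_mk _
      continuous_invFun := (hφ'.comp continuous_subtype_val).subtype_mk _ }
  ext
  rw [rootDeltaChar_apply, rootDeltaChar_apply]
  congr 3
  exact (MeasureTheory.Measure.modularCharacter_continuousMulEquiv ψ x).symm

end Representation
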